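import Summits.ValiantsHypothesis.ValiantsHypothesis.Theorems.KPlusLogSqLawTropicalSymmetricThreeFour
import Summits.ValiantsHypothesis.ValiantsHypothesis.Theorems.KPlusLogSqLawTropicalSymmetricThreeRowPairwise
import Summits.ValiantsHypothesis.ValiantsHypothesis.Theorems.KPlusLogSqLawTropicalPermutationChanges

/-!
# Route «KPlusLogSqLaw» — the SYMMETRIC `(3,4)` tropical row sharpened: `T_sym(3,4) ≤ 17` ON EVERY SUPPORT, by a face-free
# exchange argument (the kernel ceiling `18` of p459728 drops by one)

HONEST FRAMING.  Helper file (seat val-sym-lift-p2 (g5), cell `pub-symmetroid`, 2026-08-27; `--supports` the `WeakLifting` item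
stmt-ValiantsHypothesis-19561 as a helper, no closure claim).  A SMALL-FORMAT statement in the single-term-carrier model, far inside the
known regime of the cruxes; nothing here is about `TropicalB` / `WeakLifting` in their windows, Conjecture B, the real census numeral of
Door A at `(3,4)` (`PosRootLawAt 3 4 18`, OPEN, never asserted — a tropical ceiling constrains Viro-type constructions only),
`MatrixDescartes` (stmt-ValiantsHypothesis-18050) or VP ≠ VNP.  Kernel window after this file: `15 ≤ T^single_sym(3,4) ≤ 17`
(floor p469079; cell level `= 15`, two codes).

STATEMENT (`tropRow_three_four_symm_le_seventeen`, the EXACT shape of `tropRow_three_four_symm_le` with `17`): for exponents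
`d : Fin 4 → ℕ` (any support), SYMMETRIC `v ε : Fin 3 → Fin 3 → Fin 4 → ℤ` and a chain of `n + 1` uniquely dominant terms at strictly
increasing integer slopes with alternating signs, `n ≤ 17`.

PROOF (face-free; two-point exchange rules only).  Relabel classes by exponent rank (`dRank`).  The dominant terms are identity terms
`D(a)` or transpositions `T = (swap i j, c)` with `c i = c j` (`isDominant_symm_involutive`); their rank multisets are pairwise distinct
(`slope_lt_of_dominant`).  LEMMA X: if the multiset `{0,0,3}` is carried then `{0,1,2}` is not.  For `{0,1,2}` is carried by an identity
term `D(w)` only; if `{0,0,3}` is a transposition term, its 2-cycle carries rank `0` and its fixed entry `k` carries rank `3`: a `D`-term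
EARLIER than it would give `d(a_i) + d(a_j) < 2·d(c_i)` (crossing exchange, `d_add_d_lt_two_mul_of_dominant`) with `d(c_i)` minimal —
impossible — and a `D`-term LATER than it has rank `3` at the fixed entry `k` (single-entry exchange, `d_lt_of_dominant_entry`), so it is
not `{0,1,2}`; if `{0,0,3}` is an identity term `D(u)`, identity terms are entrywise comparable along the chain and neither `u ≤ w` (the
`3` of `u`) nor `w ≤ u` (the two `0`s of `u`) is possible.  Mirror: `{0,3,3}` carried ⇒ `{1,2,3}` not.  Hence two of the twenty rank
multisets are always missed: `n + 1 ≤ 18`.  (The cell's per-face computations — theory-2 g19 σ-state DP, this seat's pairwise DP — give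
`15` exactly; `16`, `15` have no face-free proof yet.)
[cell statement R1503 (b)(β) / R1624; folklore-level exchange argument, no citation exists]
-/

set_option linter.dupNamespace false
set_option autoImplicit false

namespace Summit.ValiantsHypothesis.ValiantsHypothesis.Theorems.KPlusLogSqLaw

open Summit.ValiantsHypothesis.ValiantsHypothesis.Theorems.MatrixDescartes.Negative
open Summit.ValiantsHypothesis.ValiantsHypothesis.Theorems.LacunarySymmetroidMatrixDescartes
open Summit.ValiantsHypothesis.ValiantsHypothesis.Theorems.LacunarySymmetroidMatrixDescartes.TropicalCensus
open Finset

namespace SymmetricThreeFourSeventeen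

open SymmetricThreeFour

/-! ## 1. The four patterns by class counts -/

/-- class counts of the pattern vector `(0,0,3)`. -/
theorem cnt003 : ∀ l : Fin 4, (univ.filter fun i : Fin 3 => (![0, 0, 3] : Fin 3 → Fin 4) i = l).card = (![2, 0, 0, 1] : Fin 4 → ℕ) l := by
  decide
/-- class counts of the pattern vector `(0,1,2)`. -/
theorem cnt012 : ∀ l : Fin 4, (univ.filter fun i : Fin 3 => (![0, 1, 2] : Fin 3 → Fin 4) i = l).card = (![1, 1, 1, 0] : Fin 4 → ℕ) l := by
  decide
/-- class counts of the pattern vector `(0,3,3)`. -/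
theorem cnt033 : ∀ l : Fin 4, (univ.filter fun i : Fin 3 => (![0, 3, 3] : Fin 3 → Fin 4) i = l).card = (![1, 0, 0, 2] : Fin 4 → ℕ) l := by
  decide
/-- class counts of the pattern vector `(1,2,3)`. -/
theorem cnt123 : ∀ l : Fin 4, (univ.filter fun i : Fin 3 => (![1, 2, 3] : Fin 3 → Fin 4) i = l).card = (![0, 1, 1, 1] : Fin 4 → ℕ) l := by
  decide

/-- a class with positive count occurs. -/
theorem exists_of_card_pos (u : Fin 3 → Fin 4) (l : Fin 4) (h : 0 < (univ.filter fun i => u i = l).card) : ∃ i, u i = l := by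
  obtain ⟨i, hi⟩ := card_pos.mp h
  exact ⟨i, (mem_filter.mp hi).2⟩

/-- a class with count zero does not occur. -/
theorem ne_of_card_zero (u : Fin 3 → Fin 4) (l : Fin 4) (h : (univ.filter fun i => u i = l).card = 0) (i : Fin 3) : u i ≠ l := by
  intro hi
  have : i ∈ univ.filter fun i => u i = l := mem_filter.mpr ⟨mem_univ _, hi⟩
  rw [card_eq_zero] at h
  rw [h] at this
  exact absurd this (notMem_empty i)

/-- a class with count two occurs at two distinct positions. -/
theorem exists_pair_of_card_two (u : Fin 3 → Fin 4) (l : Fin 4) (h : (univ.filter fun i => u i = l).card = 2) :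
    ∃ i j, i ≠ j ∧ u i = l ∧ u j = l := by
  obtain ⟨i, j, hij, hs⟩ := card_eq_two.mp h
  have hi : i ∈ univ.filter fun i => u i = l := by rw [hs]; exact mem_insert_self _ _
  have hj : j ∈ univ.filter fun i => u i = l := by rw [hs]; exact mem_insert_of_mem (mem_singleton_self _)
  exact ⟨i, j, hij, (mem_filter.mp hi).2, (mem_filter.mp hj).2⟩

/-! ## 2. The core: Lemma X and the count -/

/-- **CORE (face-free).**  Terms `r₀, …, r_n` of `S₃ × (Fin 3 → Fin 4)` with cycle-constant class maps such that (i) two terms using the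
same row at a column have non-decreasing classes there along the sequence, (ii) the class multisets are pairwise distinct, (iii) an
identity term is never followed by a term with a moved entry of class `0`, (iv) a term with a moved entry of class `3` is never followed
by an identity term.  Then `n ≤ 17`. [exchange-rule relaxation of the cell, PAIRWISE-CEILING-liftp2g5 §5; counting] -/
theorem core (n : ℕ) (r : Fin (n + 1) → Equiv.Perm (Fin 3) × (Fin 3 → Fin 4))
    (h1 : ∀ k i, (r k).2 ((r k).1 i) = (r k).2 i)
    (h2 : ∀ a b : Fin (n + 1), a < b → ∀ i, (r a).1 i = (r b).1 i → (r a).2 i ≤ (r b).2 i)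
    (h3 : Function.Injective fun k => TropicalCensus.classSym (r k))
    (h4 : ∀ a b : Fin (n + 1), a < b → (r a).1 = 1 → ∀ i, (r b).1 i ≠ i → (r b).2 i ≠ 0)
    (h5 : ∀ a b : Fin (n + 1), a < b → (r b).1 = 1 → ∀ i, (r a).1 i ≠ i → (r a).2 i ≠ 3) : n ≤ 17 := by
  -- counts from pattern membership
  have hcnt : ∀ (k : Fin (n + 1)) (w : Fin 3 → Fin 4),
      TropicalCensus.classSym (r k) = TropicalCensus.classSym ((1 : Equiv.Perm (Fin 3)), w) →
      ∀ l, (univ.filter fun i => (r k).2 i = l).card = (univ.filter fun i : Fin 3 => w i = l).card :=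
    fun k w h l => card_filter_eq_of_classSym_eq h l
  -- LEMMA X: {0,0,3} and {0,1,2} are not both carried
  have X1 : ∀ a b : Fin (n + 1),
      TropicalCensus.classSym (r a) = TropicalCensus.classSym ((1 : Equiv.Perm (Fin 3)), (![0, 0, 3] : Fin 3 → Fin 4)) →
      TropicalCensus.classSym (r b) = TropicalCensus.classSym ((1 : Equiv.Perm (Fin 3)), (![0, 1, 2] : Fin 3 → Fin 4)) → False := by
    intro a b ha hb
    have ca : ∀ l, (univ.filter fun i => (r a).2 i = l).card = (![2, 0, 0, 1] : Fin 4 → ℕ) l :=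
      fun l => (hcnt a _ ha l).trans (cnt003 l)
    have cb : ∀ l, (univ.filter fun i => (r b).2 i = l).card = (![1, 1, 1, 0] : Fin 4 → ℕ) l :=
      fun l => (hcnt b _ hb l).trans (cnt012 l)
    have hb1 : (r b).1 = 1 := perm_eq_one_of_card_le_one _ (h1 b) fun l => by
      rw [cb l]; fin_cases l <;> decide
    have hab : a ≠ b := by
      intro h; have := ca 0; rw [h, cb 0] at this; exact absurd this (by decide)
    have hb3 : ∀ i, (r b).2 i ≠ 3 := ne_of_card_zero _ 3 (by rw [cb 3]; rfl)
    have hb0 : ∀ i j, i ≠ j → (r b).2 i = 0 → (r b).2 j = 0 → False := by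
      intro i j hij hi hj
      have h2le := two_le_card_filter (r b) hij (hi.trans hj.symm)
      rw [hj, cb 0] at h2le
      exact absurd h2le (by decide)
    by_cases ha1 : (r a).1 = 1
    · -- both identity: comparable, impossible either way
      rcases lt_or_gt_of_ne hab with hlt | hlt
      · obtain ⟨k, hk⟩ := exists_of_card_pos _ 3 (by rw [ca 3]; decide)
        have hle := h2 a b hlt k (by rw [ha1, hb1])
        rw [hk] at hle
        exact hb3 k (le_antisymm (Fin.le_last _) hle)
      · obtain ⟨i, j, hij, hi, hj⟩ := exists_pair_of_card_two _ 0 (ca 0)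
        have hi' := h2 b a hlt i (by rw [ha1, hb1])
        have hj' := h2 b a hlt j (by rw [ha1, hb1])
        rw [hi] at hi'; rw [hj] at hj'
        exact hb0 i j hij (le_antisymm hi' (Fin.zero_le _)) (le_antisymm hj' (Fin.zero_le _))
    · -- `a` is a transposition term: moved entries carry `0`, the fixed entry carries `3`
      obtain ⟨hmov, hfix, k, hk⟩ := transposition_served (r a) 0 3 (h1 a) ha1 (by rw [ca 3]; rfl)
        (fun l hl => by rw [ca l]; fin_cases l <;> simp_all)
      rcases lt_or_gt_of_ne hab with hlt | hlt
      · -- T before D: the fixed entry forces a `3` in the identity term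
        have hle := h2 a b hlt k (by rw [hk, hb1, Equiv.Perm.one_apply])
        rw [hfix k hk] at hle
        exact hb3 k (le_antisymm (Fin.le_last _) hle)
      · -- D before T: a moved entry of class `0` after an identity term
        obtain ⟨i, hi⟩ : ∃ i, (r a).1 i ≠ i := not_forall.mp fun h => ha1 (Equiv.ext h)
        exact h4 b a hlt hb1 i hi (hmov i hi)
  -- mirror: {0,3,3} and {1,2,3} are not both carried
  have X2 : ∀ a b : Fin (n + 1),
      TropicalCensus.classSym (r a) = TropicalCensus.classSym ((1 : Equiv.Perm (Fin 3)), (![0, 3, 3] : Fin 3 → Fin 4)) →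
      TropicalCensus.classSym (r b) = TropicalCensus.classSym ((1 : Equiv.Perm (Fin 3)), (![1, 2, 3] : Fin 3 → Fin 4)) → False := by
    intro a b ha hb
    have ca : ∀ l, (univ.filter fun i => (r a).2 i = l).card = (![1, 0, 0, 2] : Fin 4 → ℕ) l :=
      fun l => (hcnt a _ ha l).trans (cnt033 l)
    have cb : ∀ l, (univ.filter fun i => (r b).2 i = l).card = (![0, 1, 1, 1] : Fin 4 → ℕ) l :=
      fun l => (hcnt b _ hb l).trans (cnt123 l)
    have hb1 : (r b).1 = 1 := perm_eq_one_of_card_le_one _ (h1 b) fun l => by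
      rw [cb l]; fin_cases l <;> decide
    have hab : a ≠ b := by
      intro h; have := ca 0; rw [h, cb 0] at this; exact absurd this (by decide)
    have hb0 : ∀ i, (r b).2 i ≠ 0 := ne_of_card_zero _ 0 (by rw [cb 0]; rfl)
    have hb3 : ∀ i j, i ≠ j → (r b).2 i = 3 → (r b).2 j = 3 → False := by
      intro i j hij hi hj
      have h2le := two_le_card_filter (r b) hij (hi.trans hj.symm)
      rw [hj, cb 3] at h2le
      exact absurd h2le (by decide)
    by_cases ha1 : (r a).1 = 1
    · rcases lt_or_gt_of_ne hab with hlt | hlt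
      · obtain ⟨i, j, hij, hi, hj⟩ := exists_pair_of_card_two _ 3 (ca 3)
        have hi' := h2 a b hlt i (by rw [ha1, hb1])
        have hj' := h2 a b hlt j (by rw [ha1, hb1])
        rw [hi] at hi'; rw [hj] at hj'
        exact hb3 i j hij (le_antisymm (Fin.le_last _) hi') (le_antisymm (Fin.le_last _) hj')
      · obtain ⟨k, hk⟩ := exists_of_card_pos _ 0 (by rw [ca 0]; decide)
        have hle := h2 b a hlt k (by rw [ha1, hb1])
        rw [hk] at hle
        exact hb0 k (le_antisymm hle (Fin.zero_le _))
    · obtain ⟨hmov, hfix, k, hk⟩ := transposition_served (r a) 3 0 (h1 a) ha1 (by rw [ca 0]; rfl)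
        (fun l hl => by rw [ca l]; fin_cases l <;> simp_all)
      rcases lt_or_gt_of_ne hab with hlt | hlt
      · -- T before D with moved class `3`
        obtain ⟨i, hi⟩ : ∃ i, (r a).1 i ≠ i := not_forall.mp fun h => ha1 (Equiv.ext h)
        exact h5 a b hlt hb1 i hi (hmov i hi)
      · -- D before T: the fixed entry forces a `0` in the identity term
        have hle := h2 b a hlt k (by rw [hk, hb1, Equiv.Perm.one_apply])
        rw [hfix k hk] at hle
        exact hb0 k (le_antisymm hle (Fin.zero_le _))
  -- COUNT: the image of `classSym ∘ r` misses one of {P003, P012} and one of {P033, P123}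
  classical
  let P : (Fin 3 → Fin 4) → Sym (Fin 4) 3 := fun w => TropicalCensus.classSym ((1 : Equiv.Perm (Fin 3)), w)
  have hPne : P ![0, 0, 3] ≠ P ![0, 3, 3] ∧ P ![0, 0, 3] ≠ P ![1, 2, 3] ∧ P ![0, 1, 2] ≠ P ![0, 3, 3] ∧ P ![0, 1, 2] ≠ P ![1, 2, 3] := by
    refine ⟨fun h => ?_, fun h => ?_, fun h => ?_, fun h => ?_⟩
    · have := card_filter_eq_of_classSym_eq h 0; rw [cnt003, cnt033] at this; exact absurd this (by decide)
    · have := card_filter_eq_of_classSym_eq h 0; rw [cnt003, cnt123] at this; exact absurd this (by decide)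
    · have := card_filter_eq_of_classSym_eq h 3; rw [cnt012, cnt033] at this; exact absurd this (by decide)
    · have := card_filter_eq_of_classSym_eq h 0; rw [cnt012, cnt123] at this; exact absurd this (by decide)
  obtain ⟨X, hX, hXmiss⟩ : ∃ X, (X = P ![0, 0, 3] ∨ X = P ![0, 1, 2]) ∧ ∀ k, TropicalCensus.classSym (r k) ≠ X := by
    by_cases hA : ∃ a, TropicalCensus.classSym (r a) = P ![0, 0, 3]
    · obtain ⟨a, ha⟩ := hA
      exact ⟨P ![0, 1, 2], Or.inr rfl, fun b hb => X1 a b ha hb⟩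
    · push Not at hA
      exact ⟨P ![0, 0, 3], Or.inl rfl, hA⟩
  obtain ⟨Y, hY, hYmiss⟩ : ∃ Y, (Y = P ![0, 3, 3] ∨ Y = P ![1, 2, 3]) ∧ ∀ k, TropicalCensus.classSym (r k) ≠ Y := by
    by_cases hA : ∃ a, TropicalCensus.classSym (r a) = P ![0, 3, 3]
    · obtain ⟨a, ha⟩ := hA
      exact ⟨P ![1, 2, 3], Or.inr rfl, fun b hb => X2 a b ha hb⟩
    · push Not at hA
      exact ⟨P ![0, 3, 3], Or.inl rfl, hA⟩
  have hXY : X ≠ Y := by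
    rcases hX with rfl | rfl <;> rcases hY with rfl | rfl
    · exact hPne.1
    · exact hPne.2.1
    · exact hPne.2.2.1
    · exact hPne.2.2.2
  have hsub : univ.image (fun k => TropicalCensus.classSym (r k)) ⊆ (univ.erase X).erase Y := by
    intro M hM
    obtain ⟨k, -, rfl⟩ := mem_image.mp hM
    exact mem_erase.mpr ⟨hYmiss k, mem_erase.mpr ⟨hXmiss k, mem_univ _⟩⟩
  have hcard := card_le_card hsub
  rw [card_image_of_injective _ h3, card_univ, Fintype.card_fin,
    card_erase_of_mem (mem_erase.mpr ⟨hXY.symm, mem_univ _⟩), card_erase_of_mem (mem_univ _), card_univ,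
    Sym.card_sym_eq_multichoose, Fintype.card_fin] at hcard
  have h20 : Nat.multichoose 4 3 = 20 := by rw [Nat.multichoose_eq]; rfl
  omega

/-- the class of minimal exponent rank has minimal exponent. -/
theorem d_le_of_dRank_eq_zero (d : Fin 4 → ℕ) {l : Fin 4} (h : dRank d l = 0) (l' : Fin 4) : d l ≤ d l' := by
  by_contra hlt
  have := dRank_lt_of_lt d (not_le.mp hlt)
  omega

/-- the class of exponent rank `3` has maximal exponent. -/
theorem d_le_of_dRank_eq_three (d : Fin 4 → ℕ) {l : Fin 4} (h : dRank d l = 3) (l' : Fin 4) : d l' ≤ d l := by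
  by_contra hlt
  have h1 := dRank_lt_of_lt d (not_le.mp hlt)
  have h2 := dRank_le d l'
  omega

end SymmetricThreeFourSeventeen

open SymmetricThreeFour SymmetricThreeFourSeventeen

/-- **`T_sym(3,4) ≤ 17` ON EVERY SUPPORT.**  A SYMMETRIC `3 × 3` dominance design with four slope classes (symmetric valuations and
signs; any exponents `d`) has at most `17` sign-alternating uniquely dominant breakpoints along increasing integer slopes.  Face-free proof:
two of the twenty class multisets are always missed (`{0,0,3}` excludes `{0,1,2}`, `{0,3,3}` excludes `{1,2,3}`), by the exchange rules
`d_lt_of_dominant_entry` (single entry) and `d_add_d_lt_two_mul_of_dominant` / `two_mul_lt_d_add_d_of_dominant` (crossing pair).  Improves the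
kernel ceiling `18` of `tropRow_three_four_symm_le`; the floor is `15` (`fifteen_le_of_symm_bound`). [cell statement R1503 (b)(β); folklore-level
exchange argument] -/
theorem tropRow_three_four_symm_le_seventeen (d : Fin 4 → ℕ) (v ε : Fin 3 → Fin 3 → Fin 4 → ℤ)
    (hv : ∀ i j l, v i j l = v j i l) (hεs : ∀ i j l, ε i j l = ε j i l)
    (n : ℕ) (θ : Fin (n + 1) → ℤ) (p : Fin (n + 1) → Equiv.Perm (Fin 3) × (Fin 3 → Fin 4))
    (hθ : StrictMono θ) (hdom : ∀ k, IsDominant d v ε (θ k) (p k))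
    (halt : ∀ k : Fin n, termSign ε (p k.castSucc) * termSign ε (p k.succ) < 0) : n ≤ 17 := by
  have hinj : Function.Injective p := stub_dominantInjective 3 4 d v ε n θ p hθ hdom halt
  -- rank relabelling of the classes: `ρ l = dRank d l` as an element of `Fin 4`
  obtain ⟨ρ, hρ⟩ : ∃ ρ : Fin 4 → Fin 4, ∀ l, (ρ l : ℕ) = dRank d l :=
    ⟨fun l => ⟨dRank d l, lt_of_le_of_lt (dRank_le d l) (by norm_num)⟩, fun _ => rfl⟩
  have hρeq : ∀ {l l' : Fin 4}, ρ l = ρ l' → d l = d l' := fun {l l'} h =>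
    d_eq_of_dRank_eq d (by rw [← hρ, ← hρ, h])
  have hρle : ∀ {l l' : Fin 4}, d l < d l' → ρ l ≤ ρ l' := fun {l l'} h => by
    rw [Fin.le_iff_val_le_val, hρ, hρ]
    exact (dRank_lt_of_lt d h).le
  have hpk : ∀ k, p k = ((p k).1, (p k).2) := fun k => rfl
  -- carriers: identity or a transposition with cycle-constant classes
  have hcar : ∀ k, (p k).1 = 1 ∨ ∃ i j : Fin 3, i < j ∧ (p k).1 = Equiv.swap i j ∧ (p k).2 i = (p k).2 j :=
    fun k => dominant_symm_three_cases d v ε hv hεs (θ k) (p k).1 (p k).2 (hdom k)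
  -- a moved entry of a transposition carrier is one of the two swapped columns
  have hmoved : ∀ (i j x : Fin 3), i < j → (Equiv.swap i j) x ≠ x → x = i ∨ x = j := by decide
  refine core n (fun k => ((p k).1, fun i => ρ ((p k).2 i))) (fun k i => ?_) (fun a b hab i hσ => ?_) ?_
    (fun a b hab ha1 i hi h0 => ?_) (fun a b hab hb1 i hi h3 => ?_)
  · -- cycle-constant classes
    have hl := (isDominant_symm_involutive d v ε hv hεs (θ k) (p k).1 (p k).2 (hdom k)).2 i
    show ρ ((p k).2 ((p k).1 i)) = ρ ((p k).2 i)
    rw [hl]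
  · -- same row at column `i` ⇒ non-decreasing rank there (single-entry exchange)
    change (p a).1 i = (p b).1 i at hσ
    show ρ ((p a).2 i) ≤ ρ ((p b).2 i)
    by_cases h : (p a).2 i = (p b).2 i
    · rw [h]
    · exact hρle (d_lt_of_dominant_entry d v ε (hθ hab) (p a).1 (p b).1 (p a).2 (p b).2 (hdom a) (hdom b) i hσ h)
  · -- the rank multisets are pairwise distinct (slopes strictly increase; equal ranks have equal exponents)
    classical
    obtain ⟨g, hg⟩ : ∃ g : Fin 4 → ℕ, ∀ l, g (ρ l) = d l := by
      refine ⟨fun s => if h : ∃ l, ρ l = s then d h.choose else 0, fun l => ?_⟩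
      have h : ∃ l', ρ l' = ρ l := ⟨l, rfl⟩
      dsimp only
      rw [dif_pos h]
      exact hρeq h.choose_spec
    have hslope : ∀ k, TropicalCensus.slope d (p k) = TropicalCensus.slope g ((p k).1, fun i => ρ ((p k).2 i)) := by
      intro k
      unfold TropicalCensus.slope
      simp only [hg]
    have key : ∀ a b : Fin (n + 1), a < b →
        TropicalCensus.classSym ((p a).1, fun i => ρ ((p a).2 i)) ≠
          TropicalCensus.classSym ((p b).1, fun i => ρ ((p b).2 i)) := by
      intro a b hlt heq
      have h1 := slope_lt_of_dominant d v ε (hθ hlt) (fun e => (ne_of_lt hlt) (hinj e)) (hdom a) (hdom b)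
      rw [hslope, hslope, slope_eq_of_classSym, slope_eq_of_classSym, heq] at h1
      exact lt_irrefl _ h1
    intro a b hab
    change TropicalCensus.classSym ((p a).1, fun i => ρ ((p a).2 i)) =
      TropicalCensus.classSym ((p b).1, fun i => ρ ((p b).2 i)) at hab
    rcases lt_trichotomy a b with h | h | h
    · exact absurd hab (key a b h)
    · exact h
    · exact absurd hab.symm (key b a h)
  · -- an identity term before a transposition term: the 2-cycle class is not of minimal rank (crossing exchange)
    change (p a).1 = 1 at ha1
    change (p b).1 i ≠ i at hi
    change ρ ((p b).2 i) = 0 at h0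
    rcases hcar b with hb1 | ⟨i', j', hij', hswap, hcc⟩
    · exact hi (by rw [hb1, Equiv.Perm.one_apply])
    · have hDa : IsDominant d v ε (θ a) (1, (p a).2) := by rw [← ha1]; exact hdom a
      have hTb : IsDominant d v ε (θ b) (Equiv.swap i' j', (p b).2) := by rw [← hswap]; exact hdom b
      have hC := d_add_d_lt_two_mul_of_dominant d v ε (hθ hab) (p a).2 (p b).2 (ne_of_lt hij') hcc hDa hTb
      -- the moved entry `i` is `i'` or `j'`, so its class is `(p b).2 i'`
      have hi2 : (p b).2 i = (p b).2 i' := by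
        rw [hswap] at hi
        rcases hmoved i' j' i hij' hi with rfl | rfl
        · rfl
        · exact hcc.symm
      have hmin : ∀ l', d ((p b).2 i') ≤ d l' := by
        intro l'
        refine d_le_of_dRank_eq_zero d ?_ l'
        rw [← hρ, ← hi2, h0]; rfl
      have := hmin ((p a).2 i')
      have := hmin ((p a).2 j')
      omega
  · -- a transposition term before an identity term: the 2-cycle class is not of maximal rank
    change (p b).1 = 1 at hb1
    change (p a).1 i ≠ i at hi
    change ρ ((p a).2 i) = 3 at h3
    rcases hcar a with ha1 | ⟨i', j', hij', hswap, hcc⟩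
    · exact hi (by rw [ha1, Equiv.Perm.one_apply])
    · have hTa : IsDominant d v ε (θ a) (Equiv.swap i' j', (p a).2) := by rw [← hswap]; exact hdom a
      have hDb : IsDominant d v ε (θ b) (1, (p b).2) := by rw [← hb1]; exact hdom b
      have hC := two_mul_lt_d_add_d_of_dominant d v ε (hθ hab) (p a).2 (p b).2 (ne_of_lt hij') hcc hTa hDb
      have hi2 : (p a).2 i = (p a).2 i' := by
        rw [hswap] at hi
        rcases hmoved i' j' i hij' hi with rfl | rfl
        · rfl
        · exact hcc.symm
      have hmax : ∀ l', d l' ≤ d ((p a).2 i') := by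
        intro l'
        refine d_le_of_dRank_eq_three d ?_ l'
        rw [← hρ, ← hi2, h3]; rfl
      have := hmax ((p b).2 i')
      have := hmax ((p b).2 j')
      omega

/-- **`¬ TropRootLawAtSymm 3 4 ·` window update**: with the row predicate of p473280, `TropRootLawAtSymm 3 4 17` (this file) — the kernel
window for the symmetric single-term `(3,4)` row becomes `[15, 17]`. [restatement] -/
theorem tropRootLawAtSymm_three_four_seventeen : Orbit.TropRootLawAtSymm 3 4 17 :=
  fun d v ε hv hε n θ p hθ hdom halt => tropRow_three_four_symm_le_seventeen d v ε hv hε n θ p hθ hdom halt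

end Summit.ValiantsHypothesis.ValiantsHypothesis.Theorems.KPlusLogSqLaw
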